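import Literature.Topology.FourManifolds.SlideReshapeLower
import HarnessLib

/-!
# Reshaping the lower arch of the rebuilt attaching circle: the ambient isotopy

Topic `Literature/Topology/FourManifolds`; fact seat `provefact-IsStrictHandleSlide.isSurgery`
(R. C. Kirby, *The Topology of 4-Manifolds*, LNM 1374 (1989), Ch. I §4; remaining content: the
named fact (S) `Literature.Topology.FourManifolds.FramedLink.IsStrictHandleSlide.slideModel`).
The planar family of `SlideReshapeLower.lean` (`BandCore.planarFamily_lowerTrack`) realised as an
ambient isotopy of `S³` with support (`PlanarFamily.isModification.exists_ambientIsotopy`,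
`PlanarBandFamily.lean`): the rebuilt attaching circle `K♮ = c.rebuild` is ambient isotopic, by an
isotopy stationary off any open set containing the band images of the tracks, to the knot `k₂`
which is the band image of the admissible lower track `(X₁, H₁)` over `S = [alo + ε/2, tlo - ε/4]`
and `K♮` elsewhere. Proved here (no definitions, no named facts):

* `Literature.Topology.FourManifolds.BandCore.exists_ambientIsotopy_lowerTrack`.

## References

* R. C. Kirby, *The Topology of 4-Manifolds*, LNM 1374, Springer (1989), Ch. I §4. [Kirby1989]
* M. W. Hirsch, *Differential Topology* (1976), Ch. 8 §1, Thm. 1.3. [HirschDT1976]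
-/

open scoped Manifold ContDiff Topology Real
open Function Set Metric

noncomputable section

namespace Literature.Topology.FourManifolds

namespace BandCore

variable {A B : Knot} {avoid : Set (Metric.sphere (0 : EuclideanSpace ℝ (Fin 4)) 1)} (c : BandCore A B avoid)

/-- **The reshaping isotopy of the lower arch.** Under the hypotheses of
`planarFamily_lowerTrack`, for every open `O ⊆ S³` containing all band images
`band ((1-u) cLo s + u (X₁ s, H₁ s))`, `u ∈ [0, 1]`, `s ∈ S`, there are an ambient isotopy `Θ` of
`S³`, stationary off `O`, and a knot `k₂` with `Θ 1 ∘ K♮ = k₂`, `k₂ (circlePt s) = band (X₁ s, H₁ s)`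
for `s ∈ S` and `k₂ (circlePt t) = K♮ (circlePt t)` for `t ∈ [alo, alo + 1) ∖ S`.
[cite: HirschDT1976, Ch. 8 §1, Thm. 1.3] -/
theorem exists_ambientIsotopy_lowerTrack (hAB : Disjoint (range ⇑A) (range ⇑B)) {X₁ H₁ : ℝ → ℝ}
    (hX₁s : ContDiff ℝ ∞ X₁) (hH₁s : ContDiff ℝ ∞ H₁)
    (hagreeX : ∀ t, t ∉ Ioo (c.alo + c.epsLo) (c.tlo - c.epsLo / 2) → X₁ t = c.cLo t 0)
    (hagreeH : ∀ t, t ∉ Ioo (c.alo + c.epsLo) (c.tlo - c.epsLo / 2) → H₁ t = c.cLo t 1)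
    (hX₁I : ∀ t, X₁ t ∈ Icc (0 : ℝ) 1) (hdX₁ : ∀ t, 0 ≤ deriv X₁ t)
    (hX₁pos : ∀ t, c.alo + c.epsLo < t → 0 < X₁ t) (hX₁lt : ∀ t, t < c.tlo - 2 * c.epsLo → X₁ t < 1)
    (hH₁I : ∀ t ∈ Icc (c.alo + c.epsLo / 2) (c.tlo - c.epsLo / 4), H₁ t ∈ Ioo (10⁻¹ : ℝ) 2⁻¹)
    (hH₁ge : ∀ t ∈ Icc (c.tlo - 2 * c.epsLo) (c.tlo - c.epsLo / 4), X₁ t = 1 → c.gLo t ≤ H₁ t)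
    (hinj₁ : InjOn (fun t ↦ (pt2 (X₁ t) (H₁ t) : EuclideanSpace ℝ (Fin 2))) (Icc (c.alo + c.epsLo / 2) (c.tlo - c.epsLo / 4)))
    (hreg₁ : ∀ s ∈ Icc (c.alo + c.epsLo / 2) (c.tlo - c.epsLo / 4), deriv X₁ s = 0 → deriv H₁ s ≠ 0)
    (hco : ∀ t ∈ Icc (c.alo + c.epsLo / 2) (c.tlo - c.epsLo / 4), ∀ t' ∈ Icc (c.alo + c.epsLo / 2) (c.tlo - c.epsLo / 4),
      t < t' → c.cLo t 0 = c.cLo t' 0 → X₁ t = X₁ t' →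
      (c.cLo t 1 < c.cLo t' 1 ∧ H₁ t < H₁ t') ∨ (c.cLo t' 1 < c.cLo t 1 ∧ H₁ t' < H₁ t))
    (hcoD : ∀ s ∈ Icc (c.alo + c.epsLo / 2) (c.tlo - c.epsLo / 4),
      deriv (fun t ↦ c.cLo t 0) s = 0 → deriv X₁ s = 0 → 0 < deriv (fun t ↦ c.cLo t 1) s * deriv H₁ s)
    {O : Set (Metric.sphere (0 : EuclideanSpace ℝ (Fin 4)) 1)} (hO : IsOpen O)
    (hOsub : ∀ u ∈ Icc (0 : ℝ) 1, ∀ s ∈ Icc (c.alo + c.epsLo / 2) (c.tlo - c.epsLo / 4),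
      c.band (pt2 ((1 - u) * c.cLo s 0 + u * X₁ s) ((1 - u) * c.cLo s 1 + u * H₁ s)) ∈ O) :
    ∃ (Θ : AmbientIsotopy (𝓡 3) (Metric.sphere (0 : EuclideanSpace ℝ (Fin 4)) 1)) (k₂ : Knot),
      (∀ t y, y ∉ O → Θ.toFun t y = y) ∧ Θ.toFun 1 ∘ ⇑(c.rebuild hAB) = ⇑k₂ ∧
      (∀ s ∈ Icc (c.alo + c.epsLo / 2) (c.tlo - c.epsLo / 4), k₂ (circlePt s) = c.band (pt2 (X₁ s) (H₁ s))) ∧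
      (∀ t ∈ Ico c.alo (c.alo + 1), t ∉ Icc (c.alo + c.epsLo / 2) (c.tlo - c.epsLo / 4) →
        k₂ (circlePt t) = c.rebuild hAB (circlePt t)) := by
  have hP := c.planarFamily_lowerTrack hAB hX₁s hH₁s hagreeX hagreeH hX₁I hdX₁ hX₁pos hX₁lt hH₁I hH₁ge hinj₁ hreg₁ hco hcoD
  have hGO : ∀ y : Metric.sphere (0 : EuclideanSpace ℝ (Fin 4)) 1, y ∉ O → ∀ u ∈ Icc (0 : ℝ) 1,
      ∀ s ∈ Icc (c.alo + c.epsLo / 2) (c.tlo - c.epsLo / 4), (y : EuclideanSpace ℝ (Fin 4)) ≠ hP.fam u s := by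
    intro y hy u hu s hs he
    rw [hP.fam_of_mem u hs, rebuildData_band] at he
    have hmem := hOsub u hu s hs
    have : y = c.band (pt2 ((1 - u) * c.cLo s 0 + u * X₁ s) ((1 - u) * c.cLo s 1 + u * H₁ s)) := Subtype.ext he
    exact hy (this ▸ hmem)
  obtain ⟨Θ, hΘO, hΘ, -⟩ := hP.isModification.exists_ambientIsotopy hO hGO
  refine ⟨Θ, hP.outKnot, hΘO, hΘ 1 ⟨zero_le_one, le_rfl⟩, fun s hs ↦ ?_, fun t ht hts ↦ ?_⟩
  · rw [hP.outKnot_circlePt_of_mem hs, rebuildData_band]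
    simp
  · exact hP.outKnot_circlePt_of_not_mem ht hts

end BandCore

end Literature.Topology.FourManifolds
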